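import Summits.QuantumFields.YangMills.Theorems.BalabanUVNodesN21AtSpineCarriersMixture
import Summits.QuantumFields.YangMills.Theorems.BalabanUVNodesN21ProfiledThresholdSyncSanity

/-!
# YM-DAG node N21 (= NE7c) AT THE SPINE CARRIERS, THRESHOLD-MIXTURE READING WITH TWO THRESHOLD FAMILIES: the located (L1) «coupling-dependent
# thresholds» under the mixture — run A averaged over `[(1 − κ)θ^A, θ^A]`, run B over `[(1 − κ)θ^B, θ^B]` (COMMON multipliers `λ ∈ [1 − κ, 1]`),
# `|θ^A − θ^B| ≤ r·θ^A` — closes the K5 stub `S_N21 SRec` through file 3's clamp synchronisation (`s_N21_of_twoThresholdReprReading`, p459145)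
# fed by file 5b's `termRepr_of_sharpMixture` at EACH run's own thresholds; and the vacuity guard with GENUINELY different thresholds

Track A of `YM-PLAN.md` (cell `pub-ymgap`, HUMAN RULING D-0062), node **N21**; R141 (C) fan-out seat `pub-ymgap-dag-n21-e` (s3 = ALTERNATIVE
CURRENCY), generation 2, file 8 — the two-threshold face of the lens memo's Card 5 (`ym-lens-BalabanUVNodes-nearmiss/LENS-nearmiss.md` v2.0 §2, last
bullet «TWO-THRESHOLD (L1) under the mixture … not separately typed»; pub-ymgap INBOX l.13275).  Companions: file 5b `…N21ThresholdMixtureRepr`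
(p467851: `termRepr_of_sharpMixture`), file 6 `…N21AtSpineCarriersMixture` (p468321: one threshold family; imported for its toy lemma), file 3 `…N21ProfiledThresholdSync` (p459145:
`n21_knit_repr_twoThresholds`, `s_N21_of_twoThresholdReprReading`) and its sanity companion 3′ `…ProfiledThresholdSyncSanity` (p460662: the two-threshold
toy).  Kernel bookkeeping BY NAME: 0 `def`, 0 `sorry`, standard axioms.  COUNT-NEUTRAL; `--supports` the K3′ item `SpineGivenEndpointR12` as a helper.

HONEST FRAMING.  NE7c is NOT PRINTED and NOT PROVED.  The two runs of node U5 read their small-field tests at COUPLING-DEPENDENT thresholds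
`ε(g^A_j)η²`, `ε(g^B_{j+1})η²` ([Balaban1988Convergent] (2.4)∕(2.17); n21-d's located (L1), p455507): two threshold families `θ^A`, `θ^B` with
relative gap `r` (node U2 ∕ N17's `U2Output`).  Under the THRESHOLD MIXTURE each run is averaged over ITS OWN box `⊗_i Leb|[(1 − κ_{a_i})θ^X_i, θ^X_i]`
— at the level of each run's marginal this IS the common-multiplier mixture `s^X_i = λ_iθ^X_i`, `λ_i` uniform on `[1 − κ_{a_i}, 1]` —, file 5b's
constructor gives `TermRepr` at `θ^A` for run A and at `θ^B` for run B, and file 3's clamp synchronisation (`termRepr_syncA∕_syncB`, `supClose_sync`)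
closes `S_N21` at width `ρ + r`.  Displayed, never discharged: (O-mix-1) the two threshold-free sharp representations (NODE O at the Stage-12
record; (K-ii) «is the threshold a free argument of `Node00.chiOfRecord`?»), (O-mix-2) `SupClose` at `θ^A` (N16) and `SiblingSuppression` of the
CLAMPED siblings at width `ρ + r` (N20) uniform over the multipliers, the gap family `r` (U2 ∕ N17), (O-mix-3) one multiplier per OCCURRENCE.  NO
(M1), NO profiled tower.  Not print's construction verbatim; N16 ∕ N17 ∕ N20 untouched; N21 NOT discharged; one finite four-torus programme at fixed
`ε`; NOT continuum ∕ ℝ⁴ ∕ OS ∕ mass gap ∕ Clay.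

CITATION HEADER (lean-in-tree rule 2026-08-18).  Everything BY NAME from the tree: file 5b `termRepr_of_sharpMixture`; file 5a
`sharpMixture_prod_eq_profile_prod`; file 3 `n21_knit_repr_twoThresholds` ∕ `s_N21_of_twoThresholdReprReading`; file 3′'s toy (`thrB_pos`, `termRepr_A'`,
`termRepr_B'`, `supClose'`, `thresholdGap'`, `siblingSuppression_A'∕_B'`, `shellW_A'`, `bandWeight'`) over pv07's `T4LipschitzLedger.Sanity`;
`T4LipschitzLedger` (`TermRepr`, `SupClose`, `sibW`, `shellW`, `termRepr_syncB` via file 3); `T4LipschitzCutoff` (`linProfile`, `SiblingSuppression`,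
`lipWeight`); `T4IndicatorShell.smallInd`; `…N21AtSpineCarriers.exists_family_and_datum`.  Context only (SHAPE): [Balaban1988Convergent] (2.4)∕(2.17) p. 255∕257.

WHAT IS PROVED ([folklore]).  §1 `n21_knit_sharpMixture_twoThresholds` (explicit carriers: two threshold-free sharp representations averaged over
their OWN boxes + `SupClose` at `θ^A` + gap `r` + `SiblingSuppression` of the clamped siblings ×2 + summable `ρ`, `r` + pinned clamped shell parts ⇒
`ShellWeightBound` at the band weight of width `ρ + r`).  §2 `s_N21_of_twoThresholdSharpMixtureReading` (the same at the K5 stub).  §3 VACUITY GUARD: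
`toy_mixture_eq_thr` (the one-factor mixture identity at ANY threshold `θ > 0`: `(θ∕2)⁻¹·∫_{[θ∕2, θ]} 1[u < s] ds = linProfile (1∕2) (u∕θ)`),
`toy_B_eq_mixture'` (file 3′'s run-B toy weight IS the normalised average over `[θ^B_K∕2, θ^B_K]`, `θ^B_K = 1 + (1∕2)^K∕8 ≠ 1`; run A's is file 6's
`toy_A_eq_mixture`), `s_N21_fires_on_twoThresholdSharpMixtureReading` (the reading is INHABITED with genuinely different thresholds, nonempty
classes, positive weights, positive run-A shell part, positive record weight; `S_N21` fires).
-/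

set_option autoImplicit false

noncomputable section

open scoped BigOperators
open MeasureTheory Set

namespace Summit.QuantumFields.YangMills.Theorems.N21AtSpineCarriersMixtureTwoThresholds

open Literature.MathematicalPhysics.QuantumFieldTheory.Balaban1983to89
open T4IndicatorShell (ShellWeightBound smallInd)
open T4LipschitzCutoff (linProfile SiblingSuppression lipWeight)
open T4LipschitzLedger (Pol TermRepr SupClose sibW shellW)
open YMDAG.UVSplit (SpineCarriers SpineRecordPred S_N21)
open N21ThresholdMixture (sharpMixture_prod_eq_profile_prod)
open N21ThresholdMixtureRepr (termRepr_of_sharpMixture)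
open N21ProfiledThresholdSync (n21_knit_repr_twoThresholds s_N21_of_twoThresholdReprReading)

/-! ## §1 Explicit carriers: two threshold families under the mixture -/

section Explicit

variable {ι : Type*} {Ω : ℕ → ι → Type*} [∀ K τ, MeasurableSpace (Ω K τ)]
  {l₀ : ℝ} {T : ℕ → Finset ι} {A B shA shB : ℕ → ℝ → ι → ℝ} {κ : ℕ → ℝ} {N : ℕ} {n : ℕ → ℕ}
  {μ : (K : ℕ) → (τ : ι) → Measure (Ω K τ)} [∀ K τ, SFinite (μ K τ)] {m : ℕ → ι → ℕ} {slot : ℕ → ι → ℕ → Σ _ : ℕ, ℕ}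
  {pol : ℕ → ι → ℕ → Pol} {θA θB : ℕ → ι → ℕ → ℝ} {uA uB : (K : ℕ) → (τ : ι) → ℕ → Ω K τ → ℝ}
  {RA RB : (K : ℕ) → ℝ → (τ : ι) → Ω K τ → ℝ} {ρ r S : ℕ → ℝ}

/-- **N21 KNIT ON THE MIXTURE ROAD WITH TWO THRESHOLD FAMILIES, EXPLICIT CARRIERS.**  As file 6's `n21_knit_sharpMixture`, but run A's sharp weights
are averaged over `⊗_i Leb|[(1 − κ_{a_i})θ^A_i, θ^A_i]` and run B's over `⊗_i Leb|[(1 − κ_{a_i})θ^B_i, θ^B_i]` (each run at ITS OWN coupling-dependent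
thresholds, both positive), with the relative gap `|θ^A_i − θ^B_i| ≤ r(K − a_i)·θ^A_i` (node U2), `SupClose` at `θ^A`, `SiblingSuppression` of the
CLAMPED siblings at width `ρ + r` in both runs and the shell parts pinned as the clamped pair's — then `ShellWeightBound l₀ T A B shA shB Wsh` for
every summable `Wsh` above the band weight at width `ρ + r` (`termRepr_of_sharpMixture` ×2 ∘ file 3's `n21_knit_repr_twoThresholds`). [folklore] -/
theorem n21_knit_sharpMixture_twoThresholds (XsA XsB : (K : ℕ) → ℝ → (τ : ι) → (Fin (m K τ) → ℝ) → ℝ)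
    (hκ : ∀ a, 0 < κ a ∧ κ a < 1)
    (thrA_pos : ∀ K, ∀ τ ∈ T K, ∀ i < m K τ, 0 < θA K τ i) (thrB_pos : ∀ K, ∀ τ ∈ T K, ∀ i < m K τ, 0 < θB K τ i)
    (slot_mem : ∀ K, ∀ τ ∈ T K, ∀ i < m K τ, slot K τ i ∈ (Finset.range (N + 1)).sigma fun a => Finset.range (n a))
    (slot_band : ∀ K, ∀ τ ∈ T K, ∀ i < m K τ, (slot K τ i).1 ≤ K)
    (meas : ∀ K, ∀ τ ∈ T K, ∀ i < m K τ, Measurable (uA K τ i) ∧ Measurable (uB K τ i))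
    (remA_nonneg : ∀ K t, |t| ≤ l₀ → ∀ τ ∈ T K, 0 ≤ᵐ[μ K τ] RA K t τ)
    (remA_int : ∀ K t, |t| ≤ l₀ → ∀ τ ∈ T K, Integrable (RA K t τ) (μ K τ))
    (remB_nonneg : ∀ K t, |t| ≤ l₀ → ∀ τ ∈ T K, 0 ≤ᵐ[μ K τ] RB K t τ)
    (remB_int : ∀ K t, |t| ≤ l₀ → ∀ τ ∈ T K, Integrable (RB K t τ) (μ K τ))
    (hXsA : ∀ K t, |t| ≤ l₀ → ∀ τ ∈ T K, ∀ s : Fin (m K τ) → ℝ,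
      XsA K t τ s = ∫ v, (∏ i : Fin (m K τ), (pol K τ i).fac (smallInd (uA K τ i v) (s i))) * RA K t τ v ∂(μ K τ))
    (hXsB : ∀ K t, |t| ≤ l₀ → ∀ τ ∈ T K, ∀ s : Fin (m K τ) → ℝ,
      XsB K t τ s = ∫ v, (∏ i : Fin (m K τ), (pol K τ i).fac (smallInd (uB K τ i v) (s i))) * RB K t τ v ∂(μ K τ))
    (hA : ∀ K t, |t| ≤ l₀ → ∀ τ ∈ T K, A K t τ =
      (∏ i : Fin (m K τ), (κ (slot K τ i).1 * θA K τ i))⁻¹ *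
        ∫ s, XsA K t τ s ∂(Measure.pi fun i : Fin (m K τ) =>
          volume.restrict (Icc ((1 - κ (slot K τ i).1) * θA K τ i) (θA K τ i))))
    (hB : ∀ K t, |t| ≤ l₀ → ∀ τ ∈ T K, B K t τ =
      (∏ i : Fin (m K τ), (κ (slot K τ i).1 * θB K τ i))⁻¹ *
        ∫ s, XsB K t τ s ∂(Measure.pi fun i : Fin (m K τ) =>
          volume.restrict (Icc ((1 - κ (slot K τ i).1) * θB K τ i) (θB K τ i))))
    (hF : SupClose T μ m slot θA uA uB ρ)
    (hθ : ∀ K, ∀ τ ∈ T K, ∀ i < m K τ, |θA K τ i - θB K τ i| ≤ r (K - (slot K τ i).1) * θA K τ i)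
    (hSA : SiblingSuppression l₀ T A N n
      (sibW (fun a => linProfile (κ a)) κ μ m slot pol θA
        (fun K τ i v => max ((1 - κ (slot K τ i).1) * θA K τ i) (min (θA K τ i) (uA K τ i v))) RA fun j => ρ j + r j) S)
    (hSB : SiblingSuppression l₀ T B N n
      (sibW (fun a => linProfile (κ a)) κ μ m slot pol θA
        (fun K τ i v => max ((1 - κ (slot K τ i).1) * θA K τ i) (min (θA K τ i) (θA K τ i / θB K τ i * uB K τ i v))) RB
        fun j => ρ j + r j) S)
    (hS : ∀ a ≤ N, 0 ≤ S a) (hρ0 : ∀ j, 0 ≤ ρ j) (hr0 : ∀ j, 0 ≤ r j) (hρ : Summable ρ) (hr : Summable r)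
    (hshA : shA = shellW (fun a => linProfile (κ a)) μ m slot pol θA
      (fun K τ i v => max ((1 - κ (slot K τ i).1) * θA K τ i) (min (θA K τ i) (uA K τ i v)))
      (fun K τ i v => max ((1 - κ (slot K τ i).1) * θA K τ i) (min (θA K τ i) (θA K τ i / θB K τ i * uB K τ i v))) RA)
    (hshB : shB = shellW (fun a => linProfile (κ a)) μ m slot pol θA
      (fun K τ i v => max ((1 - κ (slot K τ i).1) * θA K τ i) (min (θA K τ i) (θA K τ i / θB K τ i * uB K τ i v)))
      (fun K τ i v => max ((1 - κ (slot K τ i).1) * θA K τ i) (min (θA K τ i) (uA K τ i v))) RB)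
    {Wsh : ℕ → ℝ}
    (hWsh : ∀ K, ∑ a ∈ Finset.range (N + 1), (n a : ℝ) * lipWeight (fun a => (κ a)⁻¹) S (fun j => ρ j + r j) a K ≤ Wsh K)
    (hsum : Summable Wsh) : ShellWeightBound l₀ T A B shA shB Wsh :=
  n21_knit_repr_twoThresholds
    (termRepr_of_sharpMixture XsA hκ thrA_pos slot_mem slot_band meas remA_nonneg remA_int hXsA hA)
    (termRepr_of_sharpMixture XsB hκ thrB_pos slot_mem slot_band (fun K τ hτ i hi => (meas K τ hτ i hi).symm) remB_nonneg
      remB_int hXsB hB)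
    hF hθ hSA hSB hS hρ0 hr0 hρ hr hshA hshB hWsh hsum

end Explicit

/-! ## §2 At the spine carriers: `S_N21 SRec` for every two-threshold mixture reading -/

section AtCarriers

variable {N : ℕ} [NeZero N]

/-- **`S_N21` FOR EVERY TWO-THRESHOLD MIXTURE READING.**  As file 6's `s_N21_of_sharpMixtureReading` with TWO positive threshold families `θ^A`,
`θ^B` (run A's sharp weights averaged over its own box, run B's over its own), the relative gap `r` (U2 ∕ N17), `SupClose` at `θ^A` (N16),
`SiblingSuppression` of the clamped siblings at width `ρ + r` (N20), `ρ, r ≥ 0` summable, clamped shell parts pinned, `S.Wsh` summable above the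
band weight at width `ρ + r` ⟹ `S_N21 SRec` (§1).  NO (M1), NO profiled tower. [folklore] -/
theorem s_N21_of_twoThresholdSharpMixtureReading (SRec : SpineRecordPred N)
    (hread : ∀ (F : T4Continuum.T4Family) (D : YMDAG.UVSplit.Datum F N) (g₀ : ℕ → ℝ)
      (os : List (T4Continuum.ULoop F)) (S : SpineCarriers), SRec F D g₀ os S →
      ∃ (Ω : ℕ → S.ι → Type) (_mΩ : ∀ K τ, MeasurableSpace (Ω K τ)) (μ : (K : ℕ) → (τ : S.ι) → Measure (Ω K τ))
        (_sf : ∀ K τ, SFinite (μ K τ)) (κ : ℕ → ℝ) (Nw : ℕ) (n : ℕ → ℕ) (m : ℕ → S.ι → ℕ) (slot : ℕ → S.ι → ℕ → Σ _ : ℕ, ℕ)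
        (pol : ℕ → S.ι → ℕ → Pol) (θA θB : ℕ → S.ι → ℕ → ℝ) (uA uB : (K : ℕ) → (τ : S.ι) → ℕ → Ω K τ → ℝ)
        (RA RB : (K : ℕ) → ℝ → (τ : S.ι) → Ω K τ → ℝ) (XsA XsB : (K : ℕ) → ℝ → (τ : S.ι) → (Fin (m K τ) → ℝ) → ℝ)
        (ρ r Ssup : ℕ → ℝ),
        (∀ a, 0 < κ a ∧ κ a < 1) ∧
        (∀ K, ∀ τ ∈ S.T K, ∀ i < m K τ, 0 < θA K τ i) ∧ (∀ K, ∀ τ ∈ S.T K, ∀ i < m K τ, 0 < θB K τ i) ∧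
        (∀ K, ∀ τ ∈ S.T K, ∀ i < m K τ, slot K τ i ∈ (Finset.range (Nw + 1)).sigma fun a => Finset.range (n a)) ∧
        (∀ K, ∀ τ ∈ S.T K, ∀ i < m K τ, (slot K τ i).1 ≤ K) ∧
        (∀ K, ∀ τ ∈ S.T K, ∀ i < m K τ, Measurable (uA K τ i) ∧ Measurable (uB K τ i)) ∧
        (∀ K t, |t| ≤ S.l₀ → ∀ τ ∈ S.T K, 0 ≤ᵐ[μ K τ] RA K t τ) ∧
        (∀ K t, |t| ≤ S.l₀ → ∀ τ ∈ S.T K, Integrable (RA K t τ) (μ K τ)) ∧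
        (∀ K t, |t| ≤ S.l₀ → ∀ τ ∈ S.T K, 0 ≤ᵐ[μ K τ] RB K t τ) ∧
        (∀ K t, |t| ≤ S.l₀ → ∀ τ ∈ S.T K, Integrable (RB K t τ) (μ K τ)) ∧
        (∀ K t, |t| ≤ S.l₀ → ∀ τ ∈ S.T K, ∀ s : Fin (m K τ) → ℝ,
          XsA K t τ s = ∫ v, (∏ i : Fin (m K τ), (pol K τ i).fac (smallInd (uA K τ i v) (s i))) * RA K t τ v ∂(μ K τ)) ∧
        (∀ K t, |t| ≤ S.l₀ → ∀ τ ∈ S.T K, ∀ s : Fin (m K τ) → ℝ,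
          XsB K t τ s = ∫ v, (∏ i : Fin (m K τ), (pol K τ i).fac (smallInd (uB K τ i v) (s i))) * RB K t τ v ∂(μ K τ)) ∧
        (∀ K t, |t| ≤ S.l₀ → ∀ τ ∈ S.T K, S.A K t τ =
          (∏ i : Fin (m K τ), (κ (slot K τ i).1 * θA K τ i))⁻¹ *
            ∫ s, XsA K t τ s ∂(Measure.pi fun i : Fin (m K τ) =>
              volume.restrict (Icc ((1 - κ (slot K τ i).1) * θA K τ i) (θA K τ i)))) ∧
        (∀ K t, |t| ≤ S.l₀ → ∀ τ ∈ S.T K, S.B K t τ =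
          (∏ i : Fin (m K τ), (κ (slot K τ i).1 * θB K τ i))⁻¹ *
            ∫ s, XsB K t τ s ∂(Measure.pi fun i : Fin (m K τ) =>
              volume.restrict (Icc ((1 - κ (slot K τ i).1) * θB K τ i) (θB K τ i)))) ∧
        SupClose S.T μ m slot θA uA uB ρ ∧
        (∀ K, ∀ τ ∈ S.T K, ∀ i < m K τ, |θA K τ i - θB K τ i| ≤ r (K - (slot K τ i).1) * θA K τ i) ∧
        SiblingSuppression S.l₀ S.T S.A Nw n
          (sibW (fun a => linProfile (κ a)) κ μ m slot pol θA
            (fun K τ i v => max ((1 - κ (slot K τ i).1) * θA K τ i) (min (θA K τ i) (uA K τ i v))) RA fun j => ρ j + r j) Ssup ∧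
        SiblingSuppression S.l₀ S.T S.B Nw n
          (sibW (fun a => linProfile (κ a)) κ μ m slot pol θA
            (fun K τ i v => max ((1 - κ (slot K τ i).1) * θA K τ i) (min (θA K τ i) (θA K τ i / θB K τ i * uB K τ i v))) RB
            fun j => ρ j + r j) Ssup ∧
        (∀ a ≤ Nw, 0 ≤ Ssup a) ∧ (∀ j, 0 ≤ ρ j) ∧ (∀ j, 0 ≤ r j) ∧ Summable ρ ∧ Summable r ∧
        S.shA = shellW (fun a => linProfile (κ a)) μ m slot pol θA
          (fun K τ i v => max ((1 - κ (slot K τ i).1) * θA K τ i) (min (θA K τ i) (uA K τ i v)))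
          (fun K τ i v => max ((1 - κ (slot K τ i).1) * θA K τ i) (min (θA K τ i) (θA K τ i / θB K τ i * uB K τ i v))) RA ∧
        S.shB = shellW (fun a => linProfile (κ a)) μ m slot pol θA
          (fun K τ i v => max ((1 - κ (slot K τ i).1) * θA K τ i) (min (θA K τ i) (θA K τ i / θB K τ i * uB K τ i v)))
          (fun K τ i v => max ((1 - κ (slot K τ i).1) * θA K τ i) (min (θA K τ i) (uA K τ i v))) RB ∧
        (∀ K, ∑ a ∈ Finset.range (Nw + 1), (n a : ℝ) * lipWeight (fun a => (κ a)⁻¹) Ssup (fun j => ρ j + r j) a K ≤ S.Wsh K) ∧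
        Summable S.Wsh) :
    S_N21 SRec := by
  intro F D g₀ os S hS
  obtain ⟨Ω, mΩ, μ, sf, κ, Nw, n, m, slot, pol, θA, θB, uA, uB, RA, RB, XsA, XsB, ρ, r, Ssup, hκ, thrA_pos, thrB_pos, slot_mem, slot_band,
    meas, remA_nonneg, remA_int, remB_nonneg, remB_int, hXsA, hXsB, hA, hB, hF, hθ, hSA, hSB, hS0, hρ0, hr0, hρ, hr, hshA, hshB, hWsh,
    hsum⟩ := hread F D g₀ os S hS
  exact n21_knit_sharpMixture_twoThresholds XsA XsB hκ thrA_pos thrB_pos slot_mem slot_band meas remA_nonneg remA_int remB_nonneg remB_int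
    hXsA hXsB hA hB hF hθ hSA hSB hS0 hρ0 hr0 hρ hr hshA hshB hWsh hsum

end AtCarriers

/-! ## §3 Vacuity guard: file 3′'s two-threshold toy IS a pair of sharp mixtures at genuinely different thresholds, and `S_N21` FIRES on it -/

section NonVacuity

open T4LipschitzLedger.Sanity
open N21ProfiledThresholdSync (thrB_pos termRepr_A' termRepr_B' supClose' thresholdGap' siblingSuppression_A' siblingSuppression_B'
  shellW_A' bandWeight')

/-- THE ONE-FACTOR MIXTURE IDENTITY AT ANY POSITIVE THRESHOLD: the normalised average of the sharp indicator `1[u < s]` over `s ∈ [θ∕2, θ]` is the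
profile value `linProfile (1∕2) (u∕θ)` (file 5a's `sharpMixture_prod_eq_profile_prod` at `m = 1`, `κ = 1∕2`). [folklore] -/
theorem toy_mixture_eq_thr {θ : ℝ} (hθ : 0 < θ) (u : ℝ) :
    (1 / 2 * θ : ℝ)⁻¹ * ∫ s : Fin 1 → ℝ, smallInd u (s 0) ∂(Measure.pi fun _ : Fin 1 => volume.restrict (Icc ((1 - 1 / 2) * θ) θ)) =
      linProfile (1 / 2) (u / θ) := by
  have h := sharpMixture_prod_eq_profile_prod (m := 1) (fun _ => Pol.small) (fun _ => (1 / 2 : ℝ)) (fun _ => θ) (fun _ => u)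
    (fun _ => by norm_num) (fun _ => hθ)
  simp only [Fin.prod_univ_one, Pol.fac_small] at h
  rw [h]
  field_simp

/-- run B's toy weight `1∕2 − (1∕2)^K∕4` IS the normalised average over `[θ^B_K∕2, θ^B_K]`, `θ^B_K = 1 + (1∕2)^K∕8`, of its sharp weight at
`u^B_K = θ^B_K·(3∕4 + (1∕2)^K∕8)`. [folklore] -/
theorem toy_B_eq_mixture' (K : ℕ) (t : ℝ) :
    B K t () = (∏ i : Fin (m K ()), (κ (slot K () i).1 * (fun (K : ℕ) (_ : Unit) (_ : ℕ) => 1 + (1 / 2 : ℝ) ^ K / 8) K () i))⁻¹ *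
      ∫ s, (∫ v, (∏ i : Fin (m K ()), (pol K () i).fac (smallInd
          ((fun (K : ℕ) (_ : Unit) (_ : ℕ) (_ : Ω K ()) => (1 + (1 / 2 : ℝ) ^ K / 8) * (3 / 4 + (1 / 2 : ℝ) ^ K / 8)) K () i v) (s i))) *
            R K t () v ∂(μ K ()))
        ∂(Measure.pi fun i : Fin (m K ()) => volume.restrict
          (Icc ((1 - κ (slot K () i).1) * (fun (K : ℕ) (_ : Unit) (_ : ℕ) => 1 + (1 / 2 : ℝ) ^ K / 8) K () i)
            ((fun (K : ℕ) (_ : Unit) (_ : ℕ) => 1 + (1 / 2 : ℝ) ^ K / 8) K () i))) := by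
  have hθB := thrB_pos K
  show (1 / 2 : ℝ) - (1 / 2 : ℝ) ^ K / 4 = (∏ _i : Fin 1, ((1 / 2 : ℝ) * (1 + (1 / 2 : ℝ) ^ K / 8)))⁻¹ *
      ∫ s : Fin 1 → ℝ, (∫ _v : Unit, (∏ i : Fin 1, Pol.small.fac
          (smallInd ((1 + (1 / 2 : ℝ) ^ K / 8) * (3 / 4 + (1 / 2 : ℝ) ^ K / 8)) (s i))) * (1 : ℝ) ∂(Measure.dirac ()))
        ∂(Measure.pi fun _ : Fin 1 => volume.restrict (Icc ((1 - (1 / 2 : ℝ)) * (1 + (1 / 2 : ℝ) ^ K / 8)) (1 + (1 / 2 : ℝ) ^ K / 8)))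
  simp only [integral_dirac, mul_one, Fin.prod_univ_one, Pol.fac_small]
  rw [toy_mixture_eq_thr hθB, mul_div_cancel_left₀ _ hθB.ne']
  have h := profile_B K
  rw [div_one] at h
  exact h.symm

/-- **THE TWO-THRESHOLD MIXTURE READING IS INHABITED (GENUINELY DIFFERENT THRESHOLDS) AND `S_N21` FIRES ON IT.**  There is a carrier predicate `SRec`
over `SU(2)` data such that (i) `SRec` is a TWO-THRESHOLD MIXTURE reading predicate — every bundle it pins carries EXACTLY the package of §2's
`s_N21_of_twoThresholdSharpMixtureReading`; (ii) it is INHABITED by file 3′'s toy (run A at `θ^A ≡ 1` testing `3∕4`, run B at `θ^B_K = 1 + (1∕2)^K∕8`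
testing `θ^B_K(3∕4 + (1∕2)^K∕8)`, width `κ = 1∕2`, `(F∞)` width `(1∕2)^j∕4`, gap `(1∕2)^j∕8`, `S ≡ 4`), whose two runs' weights `1∕2`, `1∕2 − (1∕2)^K∕4`
ARE the normalised threshold averages of the sharp weights over EACH RUN'S OWN box (file 6's `toy_A_eq_mixture`, `toy_B_eq_mixture'`); the bundle has nonempty
classes, positive weights, positive run-A shell part, nonnegative run-B shell part and positive record weight; (iii) the two threshold families DIFFER at
every step; (iv) `S_N21 SRec` holds (by §2).  A toy, NOT Bałaban's terms. [folklore] -/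
theorem s_N21_fires_on_twoThresholdSharpMixtureReading :
    ∃ SRec : SpineRecordPred 2,
      (∃ (F : T4Continuum.T4Family) (D : YMDAG.UVSplit.Datum F 2) (g₀ : ℕ → ℝ) (os : List (T4Continuum.ULoop F))
          (S : SpineCarriers), SRec F D g₀ os S ∧ (∀ K, (S.T K).Nonempty) ∧
          (∀ K t τ, 0 < S.A K t τ ∧ 0 < S.B K t τ ∧ 0 < S.shA K t τ ∧ 0 ≤ S.shB K t τ) ∧ ∀ K, 0 < S.Wsh K) ∧
      (∀ K : ℕ, θ K () 0 ≠ 1 + (1 / 2 : ℝ) ^ K / 8) ∧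
      S_N21 SRec := by
  obtain ⟨F, ⟨Dat⟩⟩ := N21AtSpineCarriers.exists_family_and_datum
  have hρ0 : ∀ j, 0 ≤ (1 / 2 : ℝ) ^ j / 4 := fun j => by positivity
  have hr0 : ∀ j, 0 ≤ (1 / 2 : ℝ) ^ j / 8 := fun j => by positivity
  have hρ : Summable fun j => (1 / 2 : ℝ) ^ j / 4 :=
    (summable_geometric_of_lt_one (by norm_num) (by norm_num : (1 / 2 : ℝ) < 1)).div_const 4
  have hr : Summable fun j => (1 / 2 : ℝ) ^ j / 8 :=
    (summable_geometric_of_lt_one (by norm_num) (by norm_num : (1 / 2 : ℝ) < 1)).div_const 8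
  have hWsum : Summable fun K =>
      ∑ a ∈ Finset.range (0 + 1), (n a : ℝ) * lipWeight Lχ S (fun j => (1 / 2 : ℝ) ^ j / 4 + (1 / 2 : ℝ) ^ j / 8) a K := by
    rw [show (fun K => ∑ a ∈ Finset.range (0 + 1), (n a : ℝ) * lipWeight Lχ S (fun j => (1 / 2 : ℝ) ^ j / 4 + (1 / 2 : ℝ) ^ j / 8) a K) =
        fun K => 3 * (1 / 2 : ℝ) ^ K from funext bandWeight']
    exact (summable_geometric_of_lt_one (by norm_num) (by norm_num : (1 / 2 : ℝ) < 1)).mul_left 3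
  -- run B's realized shell part on the clamped pair is source-independent (`R ≡ 1`) and nonnegative
  have hshB : ∀ (K : ℕ) (t : ℝ), 0 ≤ shellW χ μ m slot pol θ
      (fun K τ i _ => max ((1 - κ (slot K τ i).1) * θ K τ i) (min (θ K τ i)
            (θ K τ i / (1 + (1 / 2 : ℝ) ^ K / 8) * ((1 + (1 / 2 : ℝ) ^ K / 8) * (3 / 4 + (1 / 2 : ℝ) ^ K / 8)))))
      (fun K τ i v => max ((1 - κ (slot K τ i).1) * θ K τ i) (min (θ K τ i) (uA K τ i v)))
      R K t () := by
    intro K t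
    have e : shellW χ μ m slot pol θ
        (fun K τ i _ => max ((1 - κ (slot K τ i).1) * θ K τ i) (min (θ K τ i)
            (θ K τ i / (1 + (1 / 2 : ℝ) ^ K / 8) * ((1 + (1 / 2 : ℝ) ^ K / 8) * (3 / 4 + (1 / 2 : ℝ) ^ K / 8)))))
        (fun K τ i v => max ((1 - κ (slot K τ i).1) * θ K τ i) (min (θ K τ i) (uA K τ i v)))
        R K t () =
      shellW χ μ m slot pol θ
        (fun K τ i _ => max ((1 - κ (slot K τ i).1) * θ K τ i) (min (θ K τ i)
            (θ K τ i / (1 + (1 / 2 : ℝ) ^ K / 8) * ((1 + (1 / 2 : ℝ) ^ K / 8) * (3 / 4 + (1 / 2 : ℝ) ^ K / 8)))))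
        (fun K τ i v => max ((1 - κ (slot K τ i).1) * θ K τ i) (min (θ K τ i) (uA K τ i v)))
        R K 0 () := rfl
    rw [e]
    exact (N21ProfiledThresholdSync.termRepr_syncB termRepr_B' termRepr_A'.thr_pos).shellW_nonneg K 0 (by simp) () (by simp [T])
  let Sb : SpineCarriers :=
    { ι := Unit, l₀ := 1, vol := 1, K₀ := 0, T := T, A := A, B := B,
      shA := shellW χ μ m slot pol θ
        (fun K τ i v => max ((1 - κ (slot K τ i).1) * θ K τ i) (min (θ K τ i) (uA K τ i v)))
        (fun K τ i _ => max ((1 - κ (slot K τ i).1) * θ K τ i) (min (θ K τ i)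
          (θ K τ i / (1 + (1 / 2 : ℝ) ^ K / 8) * ((1 + (1 / 2 : ℝ) ^ K / 8) * (3 / 4 + (1 / 2 : ℝ) ^ K / 8)))))
        R,
      shB := shellW χ μ m slot pol θ
        (fun K τ i _ => max ((1 - κ (slot K τ i).1) * θ K τ i) (min (θ K τ i)
          (θ K τ i / (1 + (1 / 2 : ℝ) ^ K / 8) * ((1 + (1 / 2 : ℝ) ^ K / 8) * (3 / 4 + (1 / 2 : ℝ) ^ K / 8)))))
        (fun K τ i v => max ((1 - κ (slot K τ i).1) * θ K τ i) (min (θ K τ i) (uA K τ i v)))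
        R,
      Bad := fun _ _ => ∅, W := fun _ => 0,
      Wsh := fun K => ∑ a ∈ Finset.range (0 + 1), (n a : ℝ) * lipWeight Lχ S (fun j => (1 / 2 : ℝ) ^ j / 4 + (1 / 2 : ℝ) ^ j / 8) a K,
      δ := fun _ => 0 }
  refine ⟨fun _ _ _ _ S => S = Sb, ⟨F, Dat, fun _ => 0, [], Sb, rfl, fun K => ⟨(), by simp [Sb, T]⟩, fun K t τ => ?_, fun K => ?_⟩,
    fun K => ?_, s_N21_of_twoThresholdSharpMixtureReading _ ?_⟩
  · obtain ⟨⟩ := τ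
    refine ⟨by norm_num [Sb, A], ?_, ?_, hshB K t⟩
    · have h1 := half_pow_le_one K
      show (0 : ℝ) < 1 / 2 - (1 / 2 : ℝ) ^ K / 4
      linarith
    · show 0 < shellW χ μ m slot pol θ
        (fun K τ i v => max ((1 - κ (slot K τ i).1) * θ K τ i) (min (θ K τ i) (uA K τ i v)))
        (fun K τ i _ => max ((1 - κ (slot K τ i).1) * θ K τ i) (min (θ K τ i)
          (θ K τ i / (1 + (1 / 2 : ℝ) ^ K / 8) * ((1 + (1 / 2 : ℝ) ^ K / 8) * (3 / 4 + (1 / 2 : ℝ) ^ K / 8)))))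
        R K t ()
      rw [shellW_A' K t]
      exact div_pos (half_pow_pos K) (by norm_num)
  · show 0 < ∑ a ∈ Finset.range (0 + 1), (n a : ℝ) * lipWeight Lχ S (fun j => (1 / 2 : ℝ) ^ j / 4 + (1 / 2 : ℝ) ^ j / 8) a K
    rw [bandWeight' K]; exact mul_pos (by norm_num) (half_pow_pos K)
  · simp only [θ, ne_eq]
    have := half_pow_pos K
    linarith
  · rintro _ _ _ _ S rfl
    exact ⟨Ω, inferInstance, μ, fun _ _ => inferInstance, κ, 0, n, m, slot, pol, θ, fun K _ _ => 1 + (1 / 2 : ℝ) ^ K / 8, uA,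
      fun K _ _ _ => (1 + (1 / 2 : ℝ) ^ K / 8) * (3 / 4 + (1 / 2 : ℝ) ^ K / 8), R, R,
      fun K t _ s => ∫ v, (∏ i : Fin (m K ()), (pol K () i).fac (smallInd (uA K () i v) (s i))) * R K t () v ∂(μ K ()),
      fun K t _ s => ∫ v, (∏ i : Fin (m K ()), (pol K () i).fac (smallInd
          ((fun (K : ℕ) (_ : Unit) (_ : ℕ) (_ : Ω K ()) => (1 + (1 / 2 : ℝ) ^ K / 8) * (3 / 4 + (1 / 2 : ℝ) ^ K / 8)) K () i v) (s i))) *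
            R K t () v ∂(μ K ()),
      fun j => (1 / 2 : ℝ) ^ j / 4, fun j => (1 / 2 : ℝ) ^ j / 8, S,
      fun _ => by norm_num [κ], termRepr_A'.thr_pos, termRepr_B'.thr_pos, termRepr_A'.slot_mem, termRepr_A'.slot_band, termRepr_A'.meas,
      termRepr_A'.rem_nonneg, termRepr_A'.rem_int, termRepr_B'.rem_nonneg, termRepr_B'.rem_int,
      fun K t _ τ _ s => by obtain ⟨⟩ := τ; rfl, fun K t _ τ _ s => by obtain ⟨⟩ := τ; rfl,
      fun K t _ τ _ => by obtain ⟨⟩ := τ; exact N21AtSpineCarriersMixture.toy_A_eq_mixture K t,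
      fun K t _ τ _ => by obtain ⟨⟩ := τ; exact toy_B_eq_mixture' K t,
      supClose', fun K τ _ i _ => thresholdGap' K τ i, siblingSuppression_A' _ _, siblingSuppression_B' _ _, fun _ _ => by norm_num [S],
      hρ0, hr0, hρ, hr, rfl, rfl, fun K => le_rfl, hWsum⟩

end NonVacuity

end Summit.QuantumFields.YangMills.Theorems.N21AtSpineCarriersMixtureTwoThresholds

end
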